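import Literature.Topology.PlaneTopology.CrosscutProofs
import Literature.Probability.RandomPlanarGeometry.PolygonalDomains
import Literature.Probability.RandomPlanarGeometry.ImageUnivalent
import Literature.Probability.RandomPlanarGeometry.BallMoebius
import HarnessLib

/-!
# Concatenation of parametrised arcs; Jordan loops through four arcs; round discs and images of Jordan domains

Topic: Topology / PlaneTopology. Plumbing for cut-and-paste arguments with Jordan domains
(the two-dimensional annulus theorem, `AnnulusTheorem.lean`; M. H. A. Newman, *Elements of the
topology of plane sets of points* (1939), Ch. V §11, θ-curves; E. E. Moise, *Geometric topology
in dimensions 2 and 3* (1977), Ch. 2–4), where a Jordan curve is assembled from finitely many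
simple arcs and one needs to know *at which parameters* the junction points sit (Newman's
cross-cut theorem `Newman1939_crosscut` addresses boundary arcs by parameter intervals):

* `concatPath γ₁ γ₂` — run through `γ₁` on `[0, ½]` and through `γ₂` on `[½, 1]` (both at
  double speed); values at `0, ½, 1`, images of sub-intervals, continuity, injectivity on
  `[0, 1]` (two arcs with one common end-point) and on `[0, 1)` (two arcs closing up a loop);
* `exists_loop_of_four_arcs` — **four simple arcs `A₀ : p₀ → p₁`, `A₁ : p₁ → p₂`,
  `A₂ : p₂ → p₃`, `A₃ : p₃ → p₀`, consecutive ones meeting only at the common end-point and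
  opposite ones disjoint, form a Jordan curve** `γ : ℝ → ℂ` (continuous, `1`-periodic,
  injective on `[0, 1)`) with `γ (k/4) = p_k` and `γ '' [k/4, (k+1)/4] = A_k`;
* `JordanDomain.carrier_eq_of_frontier_eq'` — an open connected bounded set with the same
  frontier as a Jordan domain is its carrier (a bounded connected open set whose frontier is the
  range of a Jordan loop is literally the data of the structure `JordanDomain` of
  `PlanarDomains.lean`, so no separate constructor is needed);
* `JordanDomain.imageHomeomorph` — the image of a Jordan domain under a homeomorphism of `ℂ`
  (the tree's `JordanDomain.image`, `ImageUnivalent.lean`, specialised);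
* for the round disc `JordanDomain.disc r` of the tree (`BallMoebius.lean`, boundary loop
  `t ↦ r e^{2πit}`): its boundary points at parameters `0, ¼, ½, ¾`, and the closed upper /
  lower semicircles `boundary '' [0, ½] ⊆ {0 ≤ im}`, `boundary '' [½, 1] ⊆ {im ≤ 0}`.

All folklore. Mathlib has `Path.trans` (concatenation of bundled paths with fixed end-points in
a general space) but we need the un-bundled real-parameter form matching `IsSimpleArc` /
`JordanDomain.boundary` of the tree, with images of parameter sub-intervals.
-/

noncomputable section

namespace Literature.Topology.PlaneTopology

open Set Metric Real _root_.Topology Bornology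
open Literature.Probability.RandomPlanarGeometry (JordanDomain)

/-! ### Concatenation of two parametrised arcs -/

section Concat

variable {γ₁ γ₂ : ℝ → ℂ}

/-- Concatenation of two real-parametrised arcs: `γ₁` at double speed on `[0, ½]`, then `γ₂`
at double speed on `[½, 1]`. [folklore] -/
def concatPath (γ₁ γ₂ : ℝ → ℂ) (t : ℝ) : ℂ :=
  if t ≤ 1 / 2 then γ₁ (2 * t) else γ₂ (2 * t - 1)

/-- On `[0, ½]` the concatenation is `γ₁ (2t)`. [folklore] -/
theorem concatPath_of_le_half {t : ℝ} (ht : t ≤ 1 / 2) : concatPath γ₁ γ₂ t = γ₁ (2 * t) := by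
  unfold concatPath; rw [if_pos ht]

/-- On `(½, ∞)` the concatenation is `γ₂ (2t - 1)`. [folklore] -/
theorem concatPath_of_half_lt {t : ℝ} (ht : 1 / 2 < t) : concatPath γ₁ γ₂ t = γ₂ (2 * t - 1) := by
  unfold concatPath; rw [if_neg (not_le.2 ht)]

/-- On `[½, ∞)` the concatenation is `γ₂ (2t - 1)`, provided the arcs match at the junction.
[folklore] -/
theorem concatPath_of_half_le (h : γ₁ 1 = γ₂ 0) {t : ℝ} (ht : 1 / 2 ≤ t) :
    concatPath γ₁ γ₂ t = γ₂ (2 * t - 1) := by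
  rcases ht.eq_or_lt with rfl | ht
  · rw [concatPath_of_le_half le_rfl]; norm_num [h]
  · exact concatPath_of_half_lt ht

/-- The concatenation starts where `γ₁` starts. [folklore] -/
@[simp] theorem concatPath_zero : concatPath γ₁ γ₂ 0 = γ₁ 0 := by
  rw [concatPath_of_le_half (by norm_num), mul_zero]

/-- At parameter `½` the concatenation is at the end-point of `γ₁`. [folklore] -/
@[simp] theorem concatPath_half : concatPath γ₁ γ₂ (1 / 2) = γ₁ 1 := by
  rw [concatPath_of_le_half le_rfl]; norm_num

/-- The concatenation ends where `γ₂` ends. [folklore] -/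
@[simp] theorem concatPath_one : concatPath γ₁ γ₂ 1 = γ₂ 1 := by
  rw [concatPath_of_half_lt (by norm_num)]; norm_num

/-- The concatenation of continuous arcs matching at the junction is continuous. [folklore] -/
theorem continuous_concatPath (h₁ : Continuous γ₁) (h₂ : Continuous γ₂) (h : γ₁ 1 = γ₂ 0) :
    Continuous (concatPath γ₁ γ₂) := by
  refine Continuous.if_le (h₁.comp (by fun_prop)) (h₂.comp (by fun_prop)) continuous_id
    continuous_const ?_
  rintro t rfl
  norm_num [h]

/-- Image of a sub-interval of `[0, ½]`. [folklore] -/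
theorem image_concatPath_Icc_of_le_half {a b : ℝ} (hb : b ≤ 1 / 2) :
    concatPath γ₁ γ₂ '' Icc a b = γ₁ '' Icc (2 * a) (2 * b) := by
  ext z
  constructor
  · rintro ⟨t, ht, rfl⟩
    rw [concatPath_of_le_half (ht.2.trans hb)]
    exact ⟨2 * t, ⟨by linarith [ht.1], by linarith [ht.2]⟩, rfl⟩
  · rintro ⟨s, hs, rfl⟩
    refine ⟨s / 2, ⟨by linarith [hs.1], by linarith [hs.2]⟩, ?_⟩
    rw [concatPath_of_le_half (by linarith [hs.2])]
    congr 1; ring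

/-- Image of a sub-interval of `[½, 1]` (arcs matching at the junction). [folklore] -/
theorem image_concatPath_Icc_of_half_le (h : γ₁ 1 = γ₂ 0) {a b : ℝ} (ha : 1 / 2 ≤ a) :
    concatPath γ₁ γ₂ '' Icc a b = γ₂ '' Icc (2 * a - 1) (2 * b - 1) := by
  ext z
  constructor
  · rintro ⟨t, ht, rfl⟩
    rw [concatPath_of_half_le h (ha.trans ht.1)]
    exact ⟨2 * t - 1, ⟨by linarith [ht.1], by linarith [ht.2]⟩, rfl⟩
  · rintro ⟨s, hs, rfl⟩
    refine ⟨(s + 1) / 2, ⟨by linarith [hs.1], by linarith [hs.2]⟩, ?_⟩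
    rw [concatPath_of_half_le h (by linarith [hs.1])]
    congr 1; ring

/-- The first half of the concatenation traces `γ₁ '' [0, 1]`. [folklore] -/
theorem image_concatPath_Icc_zero_half :
    concatPath γ₁ γ₂ '' Icc 0 (1 / 2) = γ₁ '' Icc 0 1 := by
  rw [image_concatPath_Icc_of_le_half le_rfl]; norm_num

/-- The second half of the concatenation traces `γ₂ '' [0, 1]`. [folklore] -/
theorem image_concatPath_Icc_half_one (h : γ₁ 1 = γ₂ 0) :
    concatPath γ₁ γ₂ '' Icc (1 / 2) 1 = γ₂ '' Icc 0 1 := by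
  rw [image_concatPath_Icc_of_half_le h le_rfl]; norm_num

/-- The whole concatenation traces `γ₁ '' [0, 1] ∪ γ₂ '' [0, 1]`. [folklore] -/
theorem image_concatPath_Icc_zero_one (h : γ₁ 1 = γ₂ 0) :
    concatPath γ₁ γ₂ '' Icc 0 1 = γ₁ '' Icc 0 1 ∪ γ₂ '' Icc 0 1 := by
  have hI : Icc (0 : ℝ) 1 = Icc 0 (1 / 2) ∪ Icc (1 / 2) 1 :=
    (Icc_union_Icc_eq_Icc (by norm_num) (by norm_num)).symm
  calc concatPath γ₁ γ₂ '' Icc 0 1 = concatPath γ₁ γ₂ '' (Icc 0 (1 / 2) ∪ Icc (1 / 2) 1) := by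
        rw [← hI]
    _ = γ₁ '' Icc 0 1 ∪ γ₂ '' Icc 0 1 := by
        rw [image_union, image_concatPath_Icc_zero_half, image_concatPath_Icc_half_one h]

/-- **Injectivity of the concatenation of two arcs with one common end-point**: if `γ₁`, `γ₂`
are injective on `[0, 1]`, match at the junction, and their traces meet only at the junction
point, the concatenation is injective on `[0, 1]`. [folklore] -/
theorem injOn_concatPath_Icc (hi₁ : InjOn γ₁ (Icc 0 1)) (hi₂ : InjOn γ₂ (Icc 0 1))
    (h : γ₁ 1 = γ₂ 0) (hmeet : γ₁ '' Icc 0 1 ∩ γ₂ '' Icc 0 1 ⊆ {γ₁ 1}) :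
    InjOn (concatPath γ₁ γ₂) (Icc 0 1) := by
  have key : ∀ u ∈ Icc (0 : ℝ) 1, ∀ u' ∈ Icc (0 : ℝ) 1, u ≤ 1 / 2 → 1 / 2 < u' →
      concatPath γ₁ γ₂ u = concatPath γ₁ γ₂ u' → u = u' := by
    intro u hu u' hu' hle hlt heq
    rw [concatPath_of_le_half hle, concatPath_of_half_lt hlt] at heq
    have hmem : γ₁ (2 * u) ∈ γ₁ '' Icc 0 1 ∩ γ₂ '' Icc 0 1 :=
      ⟨⟨2 * u, ⟨by linarith [hu.1], by linarith⟩, rfl⟩,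
        ⟨2 * u' - 1, ⟨by linarith, by linarith [hu'.2]⟩, heq.symm⟩⟩
    have h1 : γ₁ (2 * u) = γ₁ 1 := hmeet hmem
    have hu1 : 2 * u = 1 := hi₁ ⟨by linarith [hu.1], by linarith⟩ (right_mem_Icc.2 zero_le_one) h1
    have h2 : γ₂ (2 * u' - 1) = γ₂ 0 := by rw [← heq, h1, h]
    have hu2 : 2 * u' - 1 = 0 :=
      hi₂ ⟨by linarith, by linarith [hu'.2]⟩ (left_mem_Icc.2 zero_le_one) h2
    linarith
  intro u hu u' hu' heq
  rcases le_or_gt u (1 / 2) with hle | hlt <;> rcases le_or_gt u' (1 / 2) with hle' | hlt'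
  · rw [concatPath_of_le_half hle, concatPath_of_le_half hle'] at heq
    have := hi₁ ⟨by linarith [hu.1], by linarith⟩ ⟨by linarith [hu'.1], by linarith⟩ heq
    linarith
  · exact key u hu u' hu' hle hlt' heq
  · exact (key u' hu' u hu hle' hlt heq.symm).symm
  · rw [concatPath_of_half_lt hlt, concatPath_of_half_lt hlt'] at heq
    have := hi₂ ⟨by linarith, by linarith [hu.2]⟩ ⟨by linarith, by linarith [hu'.2]⟩ heq
    linarith

/-- **Injectivity of a loop made of two arcs**: if moreover `γ₂` ends where `γ₁` starts and the
traces meet only at the two junction points, the concatenation is injective on `[0, 1)`.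
[folklore] -/
theorem injOn_concatPath_Ico (hi₁ : InjOn γ₁ (Icc 0 1)) (hi₂ : InjOn γ₂ (Icc 0 1))
    (h : γ₁ 1 = γ₂ 0) (h' : γ₂ 1 = γ₁ 0)
    (hmeet : γ₁ '' Icc 0 1 ∩ γ₂ '' Icc 0 1 ⊆ {γ₁ 1, γ₁ 0}) :
    InjOn (concatPath γ₁ γ₂) (Ico 0 1) := by
  have key : ∀ u ∈ Ico (0 : ℝ) 1, ∀ u' ∈ Ico (0 : ℝ) 1, u ≤ 1 / 2 → 1 / 2 < u' →
      concatPath γ₁ γ₂ u ≠ concatPath γ₁ γ₂ u' := by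
    intro u hu u' hu' hle hlt heq
    rw [concatPath_of_le_half hle, concatPath_of_half_lt hlt] at heq
    have hmem : γ₁ (2 * u) ∈ γ₁ '' Icc 0 1 ∩ γ₂ '' Icc 0 1 :=
      ⟨⟨2 * u, ⟨by linarith [hu.1], by linarith⟩, rfl⟩,
        ⟨2 * u' - 1, ⟨by linarith, by linarith [hu'.2]⟩, heq.symm⟩⟩
    rcases hmeet hmem with h1 | h0
    · have e : γ₂ (2 * u' - 1) = γ₂ 0 := by rw [← heq, h1, h]
      have := hi₂ ⟨by linarith, by linarith [hu'.2]⟩ (left_mem_Icc.2 zero_le_one) e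
      linarith
    · have e : γ₂ (2 * u' - 1) = γ₂ 1 := by rw [← heq, h0, h']
      have := hi₂ ⟨by linarith, by linarith [hu'.2]⟩ (right_mem_Icc.2 zero_le_one) e
      linarith [hu'.2]
  intro u hu u' hu' heq
  rcases le_or_gt u (1 / 2) with hle | hlt <;> rcases le_or_gt u' (1 / 2) with hle' | hlt'
  · rw [concatPath_of_le_half hle, concatPath_of_le_half hle'] at heq
    have := hi₁ ⟨by linarith [hu.1], by linarith⟩ ⟨by linarith [hu'.1], by linarith⟩ heq
    linarith
  · exact absurd heq (key u hu u' hu' hle hlt')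
  · exact absurd heq.symm (key u' hu' u hu hle' hlt)
  · rw [concatPath_of_half_lt hlt, concatPath_of_half_lt hlt'] at heq
    have := hi₂ ⟨by linarith, by linarith [hu.2]⟩ ⟨by linarith, by linarith [hu'.2]⟩ heq
    linarith

end Concat

/-! ### Periodisation -/

section Periodise

variable {f : ℝ → ℂ}

/-- On `[0, 1]`, `f ∘ fract = f` when `f 0 = f 1`. [folklore] -/
theorem comp_fract_apply_of_mem_Icc (h : f 0 = f 1) {t : ℝ} (ht : t ∈ Icc (0 : ℝ) 1) :
    (f ∘ Int.fract) t = f t := by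
  rcases ht.2.eq_or_lt with rfl | hlt
  · simp [h]
  · simp [Int.fract_eq_self.2 ⟨ht.1, hlt⟩]

/-- Images of sub-intervals of `[0, 1]` are unchanged by periodisation. [folklore] -/
theorem image_comp_fract_Icc (h : f 0 = f 1) {a b : ℝ} (ha : 0 ≤ a) (hb : b ≤ 1) :
    (f ∘ Int.fract) '' Icc a b = f '' Icc a b :=
  image_congr fun _ ht => comp_fract_apply_of_mem_Icc h ⟨ha.trans ht.1, ht.2.trans hb⟩

/-- The periodisation is `1`-periodic. [folklore] -/
theorem periodic_comp_fract : Function.Periodic (f ∘ Int.fract) 1 := fun t =>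
  congrArg f (Int.fract_add_one t)

/-- The range of the periodisation is `f '' [0, 1]` (when `f 0 = f 1`). [folklore] -/
theorem range_comp_fract (h : f 0 = f 1) : range (f ∘ Int.fract) = f '' Icc 0 1 := by
  ext z
  constructor
  · rintro ⟨u, rfl⟩
    exact ⟨Int.fract u, ⟨Int.fract_nonneg u, (Int.fract_lt_one u).le⟩, rfl⟩
  · rintro ⟨u, hu, rfl⟩
    exact ⟨u, comp_fract_apply_of_mem_Icc h hu⟩

/-- Injectivity on `[0, 1)` is unchanged by periodisation. [folklore] -/
theorem injOn_comp_fract (hf : InjOn f (Ico 0 1)) : InjOn (f ∘ Int.fract) (Ico 0 1) := by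
  intro u hu u' hu' heq
  simp only [Function.comp_apply, Int.fract_eq_self.2 ⟨hu.1, hu.2⟩,
    Int.fract_eq_self.2 ⟨hu'.1, hu'.2⟩] at heq
  exact hf hu hu' heq

end Periodise

/-! ### A Jordan loop through four arcs -/

section FourArcs

variable {A₀ A₁ A₂ A₃ : Set ℂ} {p₀ p₁ p₂ p₃ : ℂ}

/-- **Four arcs make a Jordan curve, with parameter control.** Let `A₀` be a simple arc from
`p₀` to `p₁`, `A₁` from `p₁` to `p₂`, `A₂` from `p₂` to `p₃` and `A₃` from `p₃` back to `p₀`;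
suppose consecutive arcs meet only in their common end-point and opposite arcs are disjoint.
Then there is a continuous `1`-periodic `γ : ℝ → ℂ`, injective on `[0, 1)`, with
`γ 0 = p₀`, `γ ¼ = p₁`, `γ ½ = p₂`, `γ ¾ = p₃`, `γ '' [k/4, (k+1)/4] = A_k` and
`range γ = A₀ ∪ A₁ ∪ A₂ ∪ A₃` (Newman 1939, Ch. V §11: a θ-curve and its three simple closed
curves; here the bookkeeping form used for cutting an annulus). [folklore] -/
theorem exists_loop_of_four_arcs (h₀ : IsSimpleArc A₀ p₀ p₁) (h₁ : IsSimpleArc A₁ p₁ p₂)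
    (h₂ : IsSimpleArc A₂ p₂ p₃) (h₃ : IsSimpleArc A₃ p₃ p₀)
    (h01 : A₀ ∩ A₁ ⊆ {p₁}) (h12 : A₁ ∩ A₂ ⊆ {p₂}) (h23 : A₂ ∩ A₃ ⊆ {p₃}) (h30 : A₃ ∩ A₀ ⊆ {p₀})
    (h02 : Disjoint A₀ A₂) (h13 : Disjoint A₁ A₃) :
    ∃ γ : ℝ → ℂ, Continuous γ ∧ Function.Periodic γ 1 ∧ InjOn γ (Ico 0 1) ∧
      range γ = A₀ ∪ A₁ ∪ A₂ ∪ A₃ ∧ γ 0 = p₀ ∧ γ (1 / 4) = p₁ ∧ γ (1 / 2) = p₂ ∧ γ (3 / 4) = p₃ ∧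
      γ '' Icc 0 (1 / 4) = A₀ ∧ γ '' Icc (1 / 4) (1 / 2) = A₁ ∧ γ '' Icc (1 / 2) (3 / 4) = A₂ ∧
      γ '' Icc (3 / 4) 1 = A₃ := by
  obtain ⟨γ₀, hc₀, hi₀, hL₀, h0₀, h1₀⟩ := isSimpleArc_iff_continuous.1 h₀
  obtain ⟨γ₁, hc₁, hi₁, hL₁, h0₁, h1₁⟩ := isSimpleArc_iff_continuous.1 h₁
  obtain ⟨γ₂, hc₂, hi₂, hL₂, h0₂, h1₂⟩ := isSimpleArc_iff_continuous.1 h₂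
  obtain ⟨γ₃, hc₃, hi₃, hL₃, h0₃, h1₃⟩ := isSimpleArc_iff_continuous.1 h₃
  -- first and second halves
  set δ₁ := concatPath γ₀ γ₁ with hδ₁
  set δ₂ := concatPath γ₂ γ₃ with hδ₂
  have hj₁ : γ₀ 1 = γ₁ 0 := by rw [h1₀, h0₁]
  have hj₂ : γ₂ 1 = γ₃ 0 := by rw [h1₂, h0₃]
  have hδ₁c : Continuous δ₁ := continuous_concatPath hc₀ hc₁ hj₁
  have hδ₂c : Continuous δ₂ := continuous_concatPath hc₂ hc₃ hj₂
  have hδ₁i : InjOn δ₁ (Icc 0 1) := by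
    refine injOn_concatPath_Icc hi₀ hi₁ hj₁ ?_
    rw [hL₀, hL₁, h1₀]; exact h01
  have hδ₂i : InjOn δ₂ (Icc 0 1) := by
    refine injOn_concatPath_Icc hi₂ hi₃ hj₂ ?_
    rw [hL₂, hL₃, h1₂]; exact h23
  have hδ₁0 : δ₁ 0 = p₀ := by rw [hδ₁, concatPath_zero, h0₀]
  have hδ₁1 : δ₁ 1 = p₂ := by rw [hδ₁, concatPath_one, h1₁]
  have hδ₂0 : δ₂ 0 = p₂ := by rw [hδ₂, concatPath_zero, h0₂]
  have hδ₂1 : δ₂ 1 = p₀ := by rw [hδ₂, concatPath_one, h1₃]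
  have hδ₁im : δ₁ '' Icc 0 1 = A₀ ∪ A₁ := by
    rw [hδ₁, image_concatPath_Icc_zero_one hj₁, hL₀, hL₁]
  have hδ₂im : δ₂ '' Icc 0 1 = A₂ ∪ A₃ := by
    rw [hδ₂, image_concatPath_Icc_zero_one hj₂, hL₂, hL₃]
  -- the full loop on `[0, 1]`
  set f := concatPath δ₁ δ₂ with hf
  have hj : δ₁ 1 = δ₂ 0 := by rw [hδ₁1, hδ₂0]
  have hj' : δ₂ 1 = δ₁ 0 := by rw [hδ₂1, hδ₁0]
  have hfc : Continuous f := continuous_concatPath hδ₁c hδ₂c hj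
  have hf01 : f 0 = f 1 := by rw [hf, concatPath_zero, concatPath_one, hδ₁0, hδ₂1]
  have hfi : InjOn f (Ico 0 1) := by
    refine injOn_concatPath_Ico hδ₁i hδ₂i hj hj' ?_
    rw [hδ₁im, hδ₂im, hδ₁1, hδ₁0]
    rintro z ⟨hz₁ | hz₁, hz₂ | hz₂⟩
    · exact absurd (mem_inter hz₁ hz₂) (Set.disjoint_left.1 h02 hz₁ ∘ And.right)
    · exact Or.inr (h30 ⟨hz₂, hz₁⟩)
    · exact Or.inl (h12 ⟨hz₁, hz₂⟩)
    · exact absurd (mem_inter hz₁ hz₂) (Set.disjoint_left.1 h13 hz₁ ∘ And.right)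
  -- quarter images
  have hq₀ : f '' Icc 0 (1 / 4) = A₀ := by
    rw [hf, image_concatPath_Icc_of_le_half (by norm_num), hδ₁,
      image_concatPath_Icc_of_le_half (by norm_num), ← hL₀]
    norm_num
  have hq₁ : f '' Icc (1 / 4) (1 / 2) = A₁ := by
    rw [hf, image_concatPath_Icc_of_le_half le_rfl, hδ₁,
      image_concatPath_Icc_of_half_le hj₁ (by norm_num), ← hL₁]
    norm_num
  have hq₂ : f '' Icc (1 / 2) (3 / 4) = A₂ := by
    rw [hf, image_concatPath_Icc_of_half_le hj le_rfl, hδ₂,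
      image_concatPath_Icc_of_le_half (by norm_num), ← hL₂]
    norm_num
  have hq₃ : f '' Icc (3 / 4) 1 = A₃ := by
    rw [hf, image_concatPath_Icc_of_half_le hj (by norm_num), hδ₂,
      image_concatPath_Icc_of_half_le hj₂ (by norm_num), ← hL₃]
    norm_num
  have hfv₁ : f (1 / 4) = p₁ := by
    rw [hf, concatPath_of_le_half (by norm_num), hδ₁, concatPath_of_le_half (by norm_num), ← h1₀]
    norm_num
  have hfv₂ : f (1 / 2) = p₂ := by rw [hf, concatPath_half, hδ₁1]
  have hfv₃ : f (3 / 4) = p₃ := by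
    rw [hf, concatPath_of_half_lt (by norm_num), hδ₂, concatPath_of_le_half (by norm_num), ← h1₂]
    norm_num
  refine ⟨f ∘ Int.fract, hfc.continuousOn.comp_fract'' hf01, periodic_comp_fract,
    injOn_comp_fract hfi, ?_, ?_, ?_, ?_, ?_, ?_, ?_, ?_, ?_⟩
  · rw [range_comp_fract hf01, hf, image_concatPath_Icc_zero_one hj, hδ₁im, hδ₂im]
    simp only [union_assoc]
  · simp [hf, hδ₁0]
  · rw [comp_fract_apply_of_mem_Icc hf01 (by norm_num), hfv₁]
  · rw [comp_fract_apply_of_mem_Icc hf01 (by norm_num), hfv₂]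
  · rw [comp_fract_apply_of_mem_Icc hf01 (by norm_num), hfv₃]
  · rw [image_comp_fract_Icc hf01 le_rfl (by norm_num), hq₀]
  · rw [image_comp_fract_Icc hf01 (by norm_num) (by norm_num), hq₁]
  · rw [image_comp_fract_Icc hf01 (by norm_num) (by norm_num), hq₂]
  · rw [image_comp_fract_Icc hf01 (by norm_num) le_rfl, hq₃]

end FourArcs

end Literature.Topology.PlaneTopology

/-! ### Jordan domains: uniqueness of the inside, images under homeomorphisms, round discs -/

namespace Literature.Probability.RandomPlanarGeometry.JordanDomain

open Set Metric Real _root_.Topology Bornology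
open Literature.Topology.PlaneTopology

/-- **An open connected bounded set with the same frontier as a Jordan domain is that Jordan
domain's carrier** (uniqueness of the inside of a Jordan curve, `carrier_eq_of_frontier_eq`,
applied to the Jordan domain with carrier `U` and the same boundary loop). [folklore] -/
theorem carrier_eq_of_frontier_eq' (D : JordanDomain) {U : Set ℂ} (hUo : IsOpen U)
    (hUb : IsBounded U) (hUc : IsConnected U) (hU : frontier U = frontier D.carrier) :
    U = D.carrier :=
  carrier_eq_of_frontier_eq (D := ⟨U, D.boundary, hUo, hUb, hUc, D.continuous_boundary,
    D.periodic_boundary, D.injOn_boundary, by rw [hU, D.range_boundary]⟩) (D' := D) hU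

/-- **The image of a Jordan domain under a homeomorphism of the plane** (the tree's
`JordanDomain.image` for a map continuous and injective on the closure, specialised): carrier
`F '' D`, boundary loop `F ∘ boundary`. [folklore] -/
abbrev imageHomeomorph (D : JordanDomain) (F : ℂ ≃ₜ ℂ) : JordanDomain :=
  D.image F F.continuous.continuousOn F.injective.injOn

/-- The carrier of the image domain. [folklore] -/
@[simp] theorem imageHomeomorph_carrier (D : JordanDomain) (F : ℂ ≃ₜ ℂ) :
    (D.imageHomeomorph F).carrier = F '' D.carrier := rfl

/-- The boundary loop of the image domain. [folklore] -/
@[simp] theorem imageHomeomorph_boundary (D : JordanDomain) (F : ℂ ≃ₜ ℂ) :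
    (D.imageHomeomorph F).boundary = F ∘ D.boundary := rfl

/-- The frontier of the image domain is the image of the frontier. [folklore] -/
theorem frontier_imageHomeomorph_carrier (D : JordanDomain) (F : ℂ ≃ₜ ℂ) :
    frontier (D.imageHomeomorph F).carrier = F '' frontier D.carrier := by
  rw [imageHomeomorph_carrier, F.image_frontier]

/-- The closure of the image domain is the image of the closure. [folklore] -/
theorem closure_imageHomeomorph_carrier (D : JordanDomain) (F : ℂ ≃ₜ ℂ) :
    closure (D.imageHomeomorph F).carrier = F '' closure D.carrier := by
  rw [imageHomeomorph_carrier, F.image_closure]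

/-! #### Round discs -/

section Disc

variable {r : ℝ} {hr : 0 < r}

/-- The boundary loop of the disc is `circleMap 0 r (2πt)`. [folklore] -/
theorem disc_boundary_apply (t : ℝ) : (disc r hr).boundary t = circleMap 0 r (2 * π * t) := rfl

/-- The boundary loop of the disc in exponential form: `r e^{2πit}`. [folklore] -/
theorem disc_boundary_eq (t : ℝ) :
    (disc r hr).boundary t = r * Complex.exp (2 * π * t * Complex.I) := by
  rw [disc_boundary_apply, circleMap, zero_add]
  push_cast
  ring_nf

/-- The frontier of the disc is the circle of radius `r`. [folklore] -/
theorem frontier_disc_carrier : frontier (disc r hr).carrier = sphere 0 r := by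
  rw [carrier_disc, frontier_ball _ hr.ne']

/-- Boundary points of the disc have norm `r`. [folklore] -/
theorem norm_disc_boundary (t : ℝ) : ‖(disc r hr).boundary t‖ = r := by
  have h := (disc r hr).boundary_mem_frontier t
  rw [frontier_disc_carrier] at h
  simpa using h

/-- The boundary point at parameter `0` is `r`. [folklore] -/
@[simp] theorem disc_boundary_zero : (disc r hr).boundary 0 = r := by
  simp [disc_boundary_apply, circleMap]

/-- The boundary point at parameter `½` is `-r`. [folklore] -/
@[simp] theorem disc_boundary_half : (disc r hr).boundary (1 / 2) = -r := by
  rw [disc_boundary_eq]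
  have : (2 : ℂ) * π * (((1 : ℝ) / 2 : ℝ) : ℂ) * Complex.I = π * Complex.I := by
    push_cast; ring
  rw [this, Complex.exp_pi_mul_I]
  ring

/-- The boundary point at parameter `¼` is `ri`. [folklore] -/
@[simp] theorem disc_boundary_quarter : (disc r hr).boundary (1 / 4) = r * Complex.I := by
  rw [disc_boundary_eq]
  have : (2 : ℂ) * π * (((1 : ℝ) / 4 : ℝ) : ℂ) * Complex.I = (π / 2) * Complex.I := by
    push_cast; ring
  rw [this, Complex.exp_pi_div_two_mul_I]

/-- The boundary point at parameter `¾` is `-ri`. [folklore] -/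
@[simp] theorem disc_boundary_three_quarters :
    (disc r hr).boundary (3 / 4) = -(r * Complex.I) := by
  rw [disc_boundary_eq]
  have : (2 : ℂ) * π * (((3 : ℝ) / 4 : ℝ) : ℂ) * Complex.I = (π / 2) * Complex.I + π * Complex.I := by
    push_cast; ring
  rw [this, Complex.exp_add, Complex.exp_pi_div_two_mul_I, Complex.exp_pi_mul_I]
  ring

/-- The imaginary part along the boundary loop: `r sin (2πt)`. [folklore] -/
theorem im_disc_boundary (t : ℝ) : ((disc r hr).boundary t).im = r * Real.sin (2 * π * t) := by
  rw [disc_boundary_eq, Complex.mul_im, Complex.ofReal_re, Complex.ofReal_im, zero_mul, add_zero,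
    show (2 : ℂ) * π * t * Complex.I = ((2 * π * t : ℝ) : ℂ) * Complex.I by push_cast; ring,
    Complex.exp_ofReal_mul_I_im]

/-- The real part along the boundary loop: `r cos (2πt)`. [folklore] -/
theorem re_disc_boundary (t : ℝ) : ((disc r hr).boundary t).re = r * Real.cos (2 * π * t) := by
  rw [disc_boundary_eq, Complex.mul_re, Complex.ofReal_re, Complex.ofReal_im, zero_mul, sub_zero,
    show (2 : ℂ) * π * t * Complex.I = ((2 * π * t : ℝ) : ℂ) * Complex.I by push_cast; ring,
    Complex.exp_ofReal_mul_I_re]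

/-- The closed upper semicircle `boundary '' [0, ½]` lies in the closed upper half-plane.
[folklore] -/
theorem im_nonneg_of_mem_image_Icc_zero_half {z : ℂ} (hz : z ∈ (disc r hr).boundary '' Icc 0 (1 / 2)) :
    0 ≤ z.im := by
  obtain ⟨t, ht, rfl⟩ := hz
  rw [im_disc_boundary]
  exact mul_nonneg hr.le (Real.sin_nonneg_of_nonneg_of_le_pi (by nlinarith [pi_pos, ht.1])
    (by nlinarith [pi_pos, ht.2]))

/-- The closed lower semicircle `boundary '' [½, 1]` lies in the closed lower half-plane.
[folklore] -/
theorem im_nonpos_of_mem_image_Icc_half_one {z : ℂ} (hz : z ∈ (disc r hr).boundary '' Icc (1 / 2) 1) :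
    z.im ≤ 0 := by
  obtain ⟨t, ht, rfl⟩ := hz
  rw [im_disc_boundary]
  have : Real.sin (2 * π * t) ≤ 0 := by
    rw [← Real.sin_sub_two_pi]
    exact Real.sin_nonpos_of_nonpos_of_neg_pi_le (by nlinarith [pi_pos, ht.2])
      (by nlinarith [pi_pos, ht.1])
  nlinarith

/-- Points of the open upper semicircle `boundary '' (0, ½)` have positive imaginary part.
[folklore] -/
theorem im_pos_of_mem_image_Ioo_zero_half {z : ℂ} (hz : z ∈ (disc r hr).boundary '' Ioo 0 (1 / 2)) :
    0 < z.im := by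
  obtain ⟨t, ht, rfl⟩ := hz
  rw [im_disc_boundary]
  exact mul_pos hr (Real.sin_pos_of_pos_of_lt_pi (by nlinarith [pi_pos, ht.1])
    (by nlinarith [pi_pos, ht.2]))

/-- Points of the open lower semicircle `boundary '' (½, 1)` have negative imaginary part.
[folklore] -/
theorem im_neg_of_mem_image_Ioo_half_one {z : ℂ} (hz : z ∈ (disc r hr).boundary '' Ioo (1 / 2) 1) :
    z.im < 0 := by
  obtain ⟨t, ht, rfl⟩ := hz
  rw [im_disc_boundary]
  have : Real.sin (2 * π * t) < 0 := by
    rw [← Real.sin_sub_two_pi]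
    exact Real.sin_neg_of_neg_of_neg_pi_lt (by nlinarith [pi_pos, ht.2])
      (by nlinarith [pi_pos, ht.1])
  nlinarith

/-- The only point of the circle `‖z‖ = r` with real part `≥ r` is `r` itself. [folklore] -/
theorem eq_of_mem_sphere_of_le_re {z : ℂ} (hz : z ∈ sphere (0 : ℂ) r) (h : r ≤ z.re) : z = r := by
  rw [mem_sphere_zero_iff_norm] at hz
  have hre : z.re ≤ ‖z‖ := Complex.re_le_norm z
  have hre' : z.re = r := le_antisymm (hz ▸ hre) h
  have him : z.im = 0 := by
    have h2 : ‖z‖ ^ 2 = z.re ^ 2 + z.im ^ 2 := by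
      rw [Complex.sq_norm, Complex.normSq_apply]; ring
    rw [hz, hre'] at h2
    nlinarith
  apply Complex.ext <;> simp [hre', him]

/-- The only point of the circle `‖z‖ = r` with real part `≤ -r` is `-r`. [folklore] -/
theorem eq_of_mem_sphere_of_re_le {z : ℂ} (hz : z ∈ sphere (0 : ℂ) r) (h : z.re ≤ -r) : z = -r := by
  have hz' : -z ∈ sphere (0 : ℂ) r := by simpa using hz
  have := eq_of_mem_sphere_of_le_re (r := r) hz' (by simp; linarith)
  have h2 : z = -(-z) := (neg_neg z).symm
  rw [h2, this]

end Disc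

end Literature.Probability.RandomPlanarGeometry.JordanDomain

end
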